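import Literature.Analysis.FluidPDE.PlanarCircleWirtinger
import HarnessLib

/-!
# FunctionalMining / NoGo — HALF-SHIFT WIRTINGER TOOLS, file 1 of 2: the two-piece antiperiodic engine
# (door (c), node K6, Lemma L-λ(q); the one scalar input of the laminate rate `16π²(q−1)/q`)

search for candidate a priori estimates; no regularity claim. Cell `pub-nsfunc` (NS FUNCTIONAL MINING), nogo seat
(gen 50), tool file of the K40 line. Elementary real analysis on an interval; nothing about Navier–Stokes
dynamics, and no node of the cell is decided here (L-λ(q) = `TopEig.TopEigHeatCoercivePos q` stays OPEN in the
kernel for every real `q > 1`).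

WHY. K40b (`NoGo/TopEigHeatLaminateConstrained`) closes the whole `x₂`-laminate witness class of the wanted kill
(F2) `¬ TopEigHeatCoercivePos q` at the rate `16π²(q−1)/q`, for every real `q > 1` and both one-sided cores,
CONDITIONALLY on one scalar input typed there as `ConstrainedWirtinger q`: the Wirtinger inequality
`4π²∫₀¹u² ≤ ∫₀¹u′²` for `1`-periodic `C¹` `u` under the power-mean constraint `∫₀¹(u²)^{1/q−1/2}u = 0`. In print
this is Croce–Dacorogna, *On a generalized Wirtinger inequality*, DCDS 9 (2003), Thm 1.1 at `p = q = 2`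
(`r = 1 + 2/q ∈ [2, 3]`, i.e. `1 ≤ q ≤ 2`; Literature side: `Literature/Analysis/FluidPDE/GeneralizedWirtinger
Inequality.lean`, lit seat, exports only the printed range). The lit seat (g34) found an ELEMENTARY proof that
covers EVERY exponent — the HALF-SHIFT ARGUMENT: an odd increasing constraint `∫φ(u) = 0` forces an antipodal
zero `u(y₀) + u(y₀ + T/2) = 0`; then `u = E + M` with `E` half-periodic with a zero and `M` half-antiperiodic,
and both pieces obey a Wirtinger inequality with the SAME constant. By the cell's placement rule the statements
beyond print are the cell's own mathematics and live problem-side: this file and file 2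
(`NoGo/HalfShiftWirtinger`), whose last theorem `constrainedWirtinger_body` is the body of K40b's hypothesis for
every `q > 0`; the K40b sequel `NoGo/TopEigHeatLaminateUnconditional` then makes the laminate rate unconditional.

THIS FILE (the engine and its first instance):
* measure / phase helpers (`memLp_two_Ioc_of_bound`, `intervalIntegrable_Ioc_of_bound`,
  `cexp_neg_pi_mul_two_mul_add_one_mul_I`, `fourier_neg_mul_cexp_half`, `hasDerivAt_cexp_half`);
* **`antiperiodic_wirtinger_two_piece`** — for `a < c < b`, `T = b − a`, two `C¹` pieces `M₁` on `[a, c]`,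
  `M₂` on `[c, b]` glued continuously at `c` and ANTIPERIODIC across the ends (`M₂ b = −M₁ a`):
  `(π/T)²(∫ₐᶜM₁² + ∫_c^b M₂²) ≤ ∫ₐᶜM₁′² + ∫_c^b M₂′²` (the glued function times `e^{−iπx/T}` is `T`-periodic;
  its Fourier modes are the half-integer modes `π(2n+1)/T`, all of modulus `≥ π/T`; one integration by parts
  per piece, the boundary terms cancel by gluing + antiperiodicity; Parseval `hasSum_sq_fourierCoeffOn` twice —
  the template of the tree's `Literature.Analysis.FluidPDE.wirtinger_interval`);
* **`antiperiodic_wirtinger`** — `M b = −M a ⇒ (π/T)²∫ₐᵇM² ≤ ∫ₐᵇM′²`.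
PROVENANCE. Proof text: lit seat g34, `pub-nsfunc-lit/staged/g34/GeneralizedWirtingerInequality.v1.lean`
4c243436fac4e16d / problem-side draft `HalfShiftWirtinger.PROBLEMSIDE-DRAFT.lean` 508afc50178a6656 (2026-08-24),
declarations copied BYTE-IDENTICAL (this file = its lines 39–339; file 2 = lines 341–662); the split is for the
400-line rule only. [folklore: Wirtinger / Poincaré inequalities for (anti)periodic functions; ours = the Lean
text (proof: lit g34)] search for candidate a priori estimates; no regularity claim.
FILING (prove seat g29, REQUEST #64): declarations byte-identical to the no-go seat's staged `HalfShiftWirtingerEngine.STAGING.lean` 5ca863d827a42487; this line is the only addition (re-cut from the v2 docstring-only restage).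
-/

noncomputable section

open Set Function Filter MeasureTheory Real
open scoped Topology

namespace Summit.NavierStokesRegularity.FunctionalMining

namespace HalfShiftWirtinger

open Literature.Analysis.FluidPDE

/-- A bounded a.e.-strongly-measurable function on `Ioc a b` lies in `L²(Ioc a b)` (via `L^∞` and the finite
measure). [bookkeeping] -/
theorem memLp_two_Ioc_of_bound {f : ℝ → ℂ} {a b : ℝ}
    (hf : AEStronglyMeasurable f (volume.restrict (Ioc a b))) (C : ℝ)
    (hC : ∀ x ∈ Ioc a b, ‖f x‖ ≤ C) : MemLp f 2 (volume.restrict (Ioc a b)) := by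
  have htop : MemLp f ⊤ (volume.restrict (Ioc a b)) := by
    refine memLp_top_of_bound hf C ?_
    rw [ae_restrict_iff' measurableSet_Ioc]
    exact Eventually.of_forall hC
  exact htop.mono_exponent le_top

/-- A bounded a.e.-strongly measurable function is interval integrable on `[a, b]`. [folklore] -/
theorem intervalIntegrable_Ioc_of_bound {E : Type*} [NormedAddCommGroup E] {f : ℝ → E} {a b : ℝ}
    (hab : a ≤ b) (hf : AEStronglyMeasurable f (volume.restrict (Ioc a b))) (C : ℝ)
    (hC : ∀ x ∈ Ioc a b, ‖f x‖ ≤ C) : IntervalIntegrable f volume a b := by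
  rw [intervalIntegrable_iff_integrableOn_Ioc_of_le hab]
  have htop : MemLp f ⊤ (volume.restrict (Ioc a b)) := by
    refine memLp_top_of_bound hf C ?_
    rw [ae_restrict_iff' measurableSet_Ioc]
    exact Eventually.of_forall hC
  exact htop.integrable le_top

/-- `exp(−iπ(2n+1)) = −1`. [folklore] -/
theorem cexp_neg_pi_mul_two_mul_add_one_mul_I (n : ℤ) :
    Complex.exp (-(π * (2 * n + 1) : ℂ) * Complex.I) = -1 := by
  have h1 : -(π * (2 * n + 1) : ℂ) * Complex.I =
      ((-(n + 1) : ℤ) : ℂ) * (2 * π * Complex.I) + π * Complex.I := by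
    push_cast; ring
  rw [h1, Complex.exp_add, Complex.exp_int_mul_two_pi_mul_I, Complex.exp_pi_mul_I]; ring

/-- The half-integer phase `exp(−iπ(2n+1)x/T)` is `fourier (−n) x · exp(−iπx/T)` on
`AddCircle T`. [folklore] -/
theorem fourier_neg_mul_cexp_half {T : ℝ} (n : ℤ) (x : ℝ) :
    fourier (-n) (x : AddCircle T) * Complex.exp (((-(π * x / T) : ℝ) : ℂ) * Complex.I) =
      Complex.exp (((-(π * (2 * n + 1) / T * x) : ℝ) : ℂ) * Complex.I) := by
  rw [fourier_coe_apply, ← Complex.exp_add]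
  congr 1
  push_cast
  ring

/-- Derivative of the phase `x ↦ exp(−iκx)`. [folklore] -/
theorem hasDerivAt_cexp_half (κ x : ℝ) :
    HasDerivAt (fun y : ℝ => Complex.exp (((-(κ * y) : ℝ) : ℂ) * Complex.I))
      (Complex.exp (((-(κ * x) : ℝ) : ℂ) * Complex.I) * (((-κ : ℝ) : ℂ) * Complex.I)) x := by
  have h1 : HasDerivAt (fun y : ℝ => -(κ * y)) (-κ) x := by
    have h := (hasDerivAt_id x).const_mul (-κ)
    simpa [neg_mul] using h
  have h2 : HasDerivAt (fun y : ℝ => (((-(κ * y)) : ℝ) : ℂ) * Complex.I)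
      ((((-κ : ℝ)) : ℂ) * Complex.I) x := h1.ofReal_comp.mul_const Complex.I
  exact h2.cexp

/-- **Two-piece antiperiodic Wirtinger inequality** (the engine). For `a < c < b`, `T = b − a`,
`C¹` functions `M₁` (used on `[a, c]`) and `M₂` (used on `[c, b]`) that glue continuously at `c`
(`M₁ c = M₂ c`) and are *antiperiodic* across the ends (`M₂ b = −M₁ a`):
`(π/T)² (∫_a^c M₁² + ∫_c^b M₂²) ≤ ∫_a^c M₁′² + ∫_c^b M₂′²`.
Proof: the glued function times `exp(−iπx/T)` is continuous with equal values at `a` and `b`;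
its Fourier modes on `[a, b]` are the half-integer modes `π(2n+1)/T` of the glued function, all
of modulus `≥ π/T` (one integration by parts per piece; the boundary terms cancel by the gluing
and the antiperiodicity); Parseval (`hasSum_sq_fourierCoeffOn`) for the function and for its
piecewise derivative. [folklore: Wirtinger/Poincaré for antiperiodic functions] -/
theorem antiperiodic_wirtinger_two_piece {M₁ M₁' M₂ M₂' : ℝ → ℝ} {a c b : ℝ} (hac : a < c)
    (hcb : c < b) (h1 : ∀ x, HasDerivAt M₁ (M₁' x) x) (h1c : Continuous M₁')
    (h2 : ∀ x, HasDerivAt M₂ (M₂' x) x) (h2c : Continuous M₂') (hglue : M₁ c = M₂ c)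
    (hanti : M₂ b = -M₁ a) :
    (π / (b - a)) ^ 2 * ((∫ x in a..c, M₁ x ^ 2) + ∫ x in c..b, M₂ x ^ 2) ≤
      (∫ x in a..c, M₁' x ^ 2) + ∫ x in c..b, M₂' x ^ 2 := by
  have hab : a < b := hac.trans hcb
  have hT : 0 < b - a := sub_pos.2 hab
  have hM₁c : Continuous M₁ := continuous_iff_continuousAt.mpr fun x => (h1 x).continuousAt
  have hM₂c : Continuous M₂ := continuous_iff_continuousAt.mpr fun x => (h2 x).continuousAt
  have hsub1 : uIcc a c ⊆ uIcc a b := by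
    rw [uIcc_of_le hac.le, uIcc_of_le hab.le]; exact Icc_subset_Icc_right hcb.le
  have hsub2 : uIcc c b ⊆ uIcc a b := by
    rw [uIcc_of_le hcb.le, uIcc_of_le hab.le]; exact Icc_subset_Icc_left hac.le
  -- the glued function and its (piecewise) derivative
  obtain ⟨G, hG⟩ : ∃ G : ℝ → ℝ, G = fun x => if x ≤ c then M₁ x else M₂ x := ⟨_, rfl⟩
  obtain ⟨G', hG'⟩ : ∃ G' : ℝ → ℝ, G' = fun x => if x ≤ c then M₁' x else M₂' x := ⟨_, rfl⟩
  have hGc : Continuous G := by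
    rw [hG]
    exact continuous_if_le continuous_id continuous_const hM₁c.continuousOn hM₂c.continuousOn
      (fun x hx => by rw [hx, hglue])
  have hG'm : Measurable G' := by
    rw [hG']
    exact Measurable.ite measurableSet_Iic h1c.measurable h2c.measurable
  have hG1 : ∀ x ∈ uIcc a c, G x = M₁ x := fun x hx => by
    rw [uIcc_of_le hac.le] at hx; simp only [hG, if_pos hx.2]
  have hG2 : ∀ x ∈ uIcc c b, G x = M₂ x := fun x hx => by
    rw [uIcc_of_le hcb.le] at hx
    by_cases h : x ≤ c
    · have : x = c := le_antisymm h hx.1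
      rw [this, hG]; dsimp only; rw [if_pos le_rfl, hglue]
    · simp only [hG, if_neg h]
  have hG'1 : ∀ x ∈ uIcc a c, G' x = M₁' x := fun x hx => by
    rw [uIcc_of_le hac.le] at hx; simp only [hG', if_pos hx.2]
  have hG'2 : ∀ x ∈ uIoc c b, G' x = M₂' x := fun x hx => by
    rw [uIoc_of_le hcb.le] at hx; simp only [hG', if_neg (not_le.2 hx.1)]
  -- a bound for `G'` on `(a, b]`
  obtain ⟨C₁, hC₁⟩ := (isCompact_Icc (a := a) (b := b)).exists_bound_of_continuousOn
    h1c.continuousOn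
  obtain ⟨C₂, hC₂⟩ := (isCompact_Icc (a := a) (b := b)).exists_bound_of_continuousOn
    h2c.continuousOn
  have hG'b : ∀ x ∈ Ioc a b, ‖G' x‖ ≤ max C₁ C₂ := fun x hx => by
    rw [hG']; dsimp only
    split_ifs
    · exact (hC₁ x (Ioc_subset_Icc_self hx)).trans (le_max_left _ _)
    · exact (hC₂ x (Ioc_subset_Icc_self hx)).trans (le_max_right _ _)
  -- the twist and the twisted functions
  obtain ⟨τ, hτ⟩ : ∃ τ : ℝ → ℂ,
      τ = fun x => Complex.exp (((-(π * x / (b - a)) : ℝ) : ℂ) * Complex.I) := ⟨_, rfl⟩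
  have hτn : ∀ x, ‖τ x‖ = 1 := fun x => by rw [hτ]; exact Complex.norm_exp_ofReal_mul_I _
  have hτc : Continuous τ := by rw [hτ]; fun_prop
  obtain ⟨P, hP⟩ : ∃ P : ℝ → ℂ, P = fun x => (G x : ℂ) * τ x := ⟨_, rfl⟩
  obtain ⟨Q, hQ⟩ : ∃ Q : ℝ → ℂ, Q = fun x => (G' x : ℂ) * τ x := ⟨_, rfl⟩
  have hPc : Continuous P := by rw [hP]; exact (Complex.continuous_ofReal.comp hGc).mul hτc
  have hPn : ∀ x, ‖P x‖ ^ 2 = G x ^ 2 := fun x => by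
    rw [hP]; dsimp only
    rw [norm_mul, hτn, mul_one, Complex.norm_real, Real.norm_eq_abs, sq_abs]
  have hQn : ∀ x, ‖Q x‖ ^ 2 = G' x ^ 2 := fun x => by
    rw [hQ]; dsimp only
    rw [norm_mul, hτn, mul_one, Complex.norm_real, Real.norm_eq_abs, sq_abs]
  have hQm : AEStronglyMeasurable Q (volume.restrict (Ioc a b)) := by
    rw [hQ]
    exact ((Complex.measurable_ofReal.comp hG'm).mul hτc.measurable).aestronglyMeasurable
  have hQb : ∀ x ∈ Ioc a b, ‖Q x‖ ≤ max C₁ C₂ := fun x hx => by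
    have : ‖Q x‖ = ‖G' x‖ := by
      rw [hQ]; dsimp only; rw [norm_mul, hτn, mul_one, Complex.norm_real]
    rw [this]; exact hG'b x hx
  -- square integrability and Parseval
  have hPL : MemLp P 2 (volume.restrict (Ioc a b)) := memLp_two_Ioc_of_continuous' hPc a b
  have hQL : MemLp Q 2 (volume.restrict (Ioc a b)) := memLp_two_Ioc_of_bound hQm _ hQb
  have PP := hasSum_sq_fourierCoeffOn hab hPL
  have PQ := hasSum_sq_fourierCoeffOn hab hQL
  simp only [smul_eq_mul] at PP PQ
  have hQi : IntervalIntegrable Q volume a b := intervalIntegrable_Ioc_of_bound hab.le hQm _ hQb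
  -- the key identity: `c_n(Q) = i κ_n c_n(P)`, `κ_n = π(2n+1)/T`
  have key : ∀ n : ℤ, fourierCoeffOn hab Q n =
      ((((π * (2 * n + 1) / (b - a)) : ℝ) : ℂ) * Complex.I) * fourierCoeffOn hab P n := by
    intro n
    set κ : ℝ := π * (2 * n + 1) / (b - a) with hκ
    obtain ⟨e, he⟩ : ∃ e : ℝ → ℂ,
        e = fun x => Complex.exp (((-(κ * x) : ℝ) : ℂ) * Complex.I) := ⟨_, rfl⟩
    have hed : ∀ x, HasDerivAt e (e x * ((((-κ : ℝ)) : ℂ) * Complex.I)) x := by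
      intro x; rw [he]; exact hasDerivAt_cexp_half κ x
    have hec : Continuous e := by rw [he]; fun_prop
    have he'c : Continuous fun x => e x * ((((-κ : ℝ)) : ℂ) * Complex.I) :=
      hec.mul continuous_const
    have hfe : ∀ x : ℝ, fourier (-n) (x : AddCircle (b - a)) * τ x = e x := by
      intro x; rw [hτ, he]; dsimp only
      rw [fourier_neg_mul_cexp_half]
    -- `e(b) = -e(a)`
    have heb : e b = -e a := by
      rw [he]; dsimp only
      have : (((-(κ * b)) : ℝ) : ℂ) * Complex.I =
          (((-(κ * a)) : ℝ) : ℂ) * Complex.I + (-(π * (2 * n + 1) : ℂ) * Complex.I) := by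
        have hb : κ * b = κ * a + π * (2 * n + 1) := by
          have hκT : κ * (b - a) = π * (2 * n + 1) := by rw [hκ]; field_simp
          linear_combination hκT
        rw [hb]; push_cast; ring
      rw [this, Complex.exp_add, cexp_neg_pi_mul_two_mul_add_one_mul_I]; ring
    -- the coefficients as phase integrals
    have hcQ : fourierCoeffOn hab Q n = (1 / (b - a) : ℝ) • ∫ x in a..b, e x * (G' x : ℂ) := by
      rw [fourierCoeffOn_eq_integral Q n hab]
      congr 1
      apply intervalIntegral.integral_congr
      intro x _
      rw [hQ]; dsimp only; rw [smul_eq_mul, ← hfe x]; ring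
    have hcP : fourierCoeffOn hab P n = (1 / (b - a) : ℝ) • ∫ x in a..b, e x * (G x : ℂ) := by
      rw [fourierCoeffOn_eq_integral P n hab]
      congr 1
      apply intervalIntegral.integral_congr
      intro x _
      rw [hP]; dsimp only; rw [smul_eq_mul, ← hfe x]; ring
    -- integrability of the phase integrands
    have hiQ : IntervalIntegrable (fun x => e x * (G' x : ℂ)) volume a b := by
      refine intervalIntegrable_Ioc_of_bound hab.le ?_ (max C₁ C₂) fun x hx => ?_
      · exact (hec.measurable.mul (Complex.measurable_ofReal.comp hG'm)).aestronglyMeasurable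
      · rw [norm_mul, he]; dsimp only
        rw [Complex.norm_exp_ofReal_mul_I, one_mul, Complex.norm_real]; exact hG'b x hx
    have hiP : IntervalIntegrable (fun x => e x * (G x : ℂ)) volume a b :=
      (hec.mul (Complex.continuous_ofReal.comp hGc)).intervalIntegrable _ _
    -- integration by parts on each piece
    have ibp1 := intervalIntegral.integral_mul_deriv_eq_deriv_mul (a := a) (b := c)
      (u := e) (v := fun x => (M₁ x : ℂ)) (u' := fun x => e x * ((((-κ : ℝ)) : ℂ) * Complex.I))
      (v' := fun x => (M₁' x : ℂ)) (fun x _ => hed x) (fun x _ => (h1 x).ofReal_comp)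
      (he'c.intervalIntegrable _ _) ((Complex.continuous_ofReal.comp h1c).intervalIntegrable _ _)
    have ibp2 := intervalIntegral.integral_mul_deriv_eq_deriv_mul (a := c) (b := b)
      (u := e) (v := fun x => (M₂ x : ℂ)) (u' := fun x => e x * ((((-κ : ℝ)) : ℂ) * Complex.I))
      (v' := fun x => (M₂' x : ℂ)) (fun x _ => hed x) (fun x _ => (h2 x).ofReal_comp)
      (he'c.intervalIntegrable _ _) ((Complex.continuous_ofReal.comp h2c).intervalIntegrable _ _)
    have hI1 : ∫ x in a..c, e x * ((((-κ : ℝ)) : ℂ) * Complex.I) * (M₁ x : ℂ) =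
        ((((-κ : ℝ)) : ℂ) * Complex.I) * ∫ x in a..c, e x * (M₁ x : ℂ) := by
      rw [← intervalIntegral.integral_const_mul]
      apply intervalIntegral.integral_congr; intro x _; ring
    have hI2 : ∫ x in c..b, e x * ((((-κ : ℝ)) : ℂ) * Complex.I) * (M₂ x : ℂ) =
        ((((-κ : ℝ)) : ℂ) * Complex.I) * ∫ x in c..b, e x * (M₂ x : ℂ) := by
      rw [← intervalIntegral.integral_const_mul]
      apply intervalIntegral.integral_congr; intro x _; ring
    -- split the phase integrals at `c`
    have hsQ : ∫ x in a..b, e x * (G' x : ℂ) =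
        (∫ x in a..c, e x * (M₁' x : ℂ)) + ∫ x in c..b, e x * (M₂' x : ℂ) := by
      rw [← intervalIntegral.integral_add_adjacent_intervals (hiQ.mono_set hsub1)
        (hiQ.mono_set hsub2)]
      congr 1
      · exact intervalIntegral.integral_congr fun x hx => by simp only [hG'1 x hx]
      · exact intervalIntegral.integral_congr_ae (Eventually.of_forall fun x hx => by
          simp only [hG'2 x hx])
    have hsP : ∫ x in a..b, e x * (G x : ℂ) =
        (∫ x in a..c, e x * (M₁ x : ℂ)) + ∫ x in c..b, e x * (M₂ x : ℂ) := by
      rw [← intervalIntegral.integral_add_adjacent_intervals (hiP.mono_set hsub1)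
        (hiP.mono_set hsub2)]
      congr 1
      · exact intervalIntegral.integral_congr fun x hx => by simp only [hG1 x hx]
      · exact intervalIntegral.integral_congr fun x hx => by simp only [hG2 x hx]
    -- assemble
    have hmain : ∫ x in a..b, e x * (G' x : ℂ) =
        ((κ : ℝ) : ℂ) * Complex.I * ∫ x in a..b, e x * (G x : ℂ) := by
      rw [hsQ, ibp1, ibp2, hI1, hI2, hsP, heb]
      push_cast
      have hg : (M₁ c : ℂ) = M₂ c := by rw [hglue]
      have ha : (M₂ b : ℂ) = -M₁ a := by rw [hanti]; push_cast; ring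
      rw [hg, ha]
      ring
    rw [hcQ, hcP, hmain, Complex.real_smul, Complex.real_smul]
    push_cast
    ring
  -- termwise comparison of the two Parseval series
  have hterm : ∀ n : ℤ, (π / (b - a)) ^ 2 * ‖fourierCoeffOn hab P n‖ ^ 2 ≤
      ‖fourierCoeffOn hab Q n‖ ^ 2 := by
    intro n
    rw [key n, norm_mul, norm_mul, Complex.norm_I, mul_one, Complex.norm_real, mul_pow,
      Real.norm_eq_abs, sq_abs]
    have hn1 : (1 : ℝ) ≤ |(2 * n + 1 : ℝ)| := by
      have h0 : (2 * n + 1 : ℤ) ≠ 0 := by omega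
      have h1 := Int.one_le_abs h0
      rw [show (2 * n + 1 : ℝ) = ((2 * n + 1 : ℤ) : ℝ) by push_cast; ring, ← Int.cast_abs]
      exact_mod_cast h1
    have h2 : (π / (b - a)) ^ 2 ≤ (π * (2 * n + 1) / (b - a)) ^ 2 := by
      rw [show π * (2 * n + 1) / (b - a) = (π / (b - a)) * (2 * n + 1 : ℝ) by ring, mul_pow,
        ← sq_abs (2 * n + 1 : ℝ)]
      have : (1 : ℝ) ≤ |(2 * n + 1 : ℝ)| ^ 2 := by nlinarith
      have h0 : 0 ≤ (π / (b - a)) ^ 2 := sq_nonneg _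
      nlinarith
    exact mul_le_mul_of_nonneg_right h2 (sq_nonneg _)
  have h := hasSum_le hterm (PP.mul_left ((π / (b - a)) ^ 2)) PQ
  -- rewrite the two integrals
  have hIP : ∫ x in a..b, ‖P x‖ ^ 2 = (∫ x in a..c, M₁ x ^ 2) + ∫ x in c..b, M₂ x ^ 2 := by
    have e1 : ∫ x in a..b, ‖P x‖ ^ 2 = ∫ x in a..b, G x ^ 2 :=
      intervalIntegral.integral_congr fun x _ => hPn x
    have hi : IntervalIntegrable (fun x => G x ^ 2) volume a b :=
      (hGc.pow 2).intervalIntegrable _ _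
    rw [e1, ← intervalIntegral.integral_add_adjacent_intervals (hi.mono_set hsub1)
      (hi.mono_set hsub2)]
    congr 1
    · exact intervalIntegral.integral_congr fun x hx => by simp only [hG1 x hx]
    · exact intervalIntegral.integral_congr fun x hx => by simp only [hG2 x hx]
  have hIQ : ∫ x in a..b, ‖Q x‖ ^ 2 = (∫ x in a..c, M₁' x ^ 2) + ∫ x in c..b, M₂' x ^ 2 := by
    have e1 : ∫ x in a..b, ‖Q x‖ ^ 2 = ∫ x in a..b, G' x ^ 2 :=
      intervalIntegral.integral_congr fun x _ => hQn x
    have hi : IntervalIntegrable (fun x => G' x ^ 2) volume a b := by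
      refine intervalIntegrable_Ioc_of_bound hab.le ?_ ((max C₁ C₂) ^ 2) fun x hx => ?_
      · exact (hG'm.pow_const 2).aestronglyMeasurable
      · rw [Real.norm_eq_abs, abs_pow, sq_abs]
        have h0 : 0 ≤ ‖G' x‖ := norm_nonneg _
        have h1 := hG'b x hx
        rw [show G' x ^ 2 = ‖G' x‖ ^ 2 by rw [Real.norm_eq_abs, sq_abs]]
        exact pow_le_pow_left₀ h0 h1 2
    rw [e1, ← intervalIntegral.integral_add_adjacent_intervals (hi.mono_set hsub1)
      (hi.mono_set hsub2)]
    congr 1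
    · exact intervalIntegral.integral_congr fun x hx => by simp only [hG'1 x hx]
    · exact intervalIntegral.integral_congr_ae (Eventually.of_forall fun x hx => by
        simp only [hG'2 x hx])
  rw [hIP] at h; rw [hIQ] at h
  -- `h : (π/T)² (T⁻¹ A) ≤ T⁻¹ B`; multiply by `T`
  have := mul_le_mul_of_nonneg_left h hT.le
  calc (π / (b - a)) ^ 2 * ((∫ x in a..c, M₁ x ^ 2) + ∫ x in c..b, M₂ x ^ 2)
      = (b - a) * ((π / (b - a)) ^ 2 *
          ((b - a)⁻¹ * ((∫ x in a..c, M₁ x ^ 2) + ∫ x in c..b, M₂ x ^ 2))) := by field_simp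
    _ ≤ (b - a) * ((b - a)⁻¹ * ((∫ x in a..c, M₁' x ^ 2) + ∫ x in c..b, M₂' x ^ 2)) := this
    _ = _ := by field_simp


/-- **Antiperiodic Wirtinger inequality.** For a `C¹` function `M` with `M b = −M a` (`a < b`,
`T = b − a`): `(π/T)² ∫_a^b M² ≤ ∫_a^b M′²` (the engine with both pieces equal to `M`).
[folklore] -/
theorem antiperiodic_wirtinger {M M' : ℝ → ℝ} {a b : ℝ} (hab : a < b)
    (hM : ∀ x, HasDerivAt M (M' x) x) (hM'c : Continuous M') (hanti : M b = -M a) :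
    (π / (b - a)) ^ 2 * ∫ x in a..b, M x ^ 2 ≤ ∫ x in a..b, M' x ^ 2 := by
  have hMc : Continuous M := continuous_iff_continuousAt.mpr fun x => (hM x).continuousAt
  have hac : a < (a + b) / 2 := by linarith
  have hcb : (a + b) / 2 < b := by linarith
  have h := antiperiodic_wirtinger_two_piece hac hcb hM hM'c hM hM'c rfl hanti
  have hi : IntervalIntegrable (fun x => M x ^ 2) volume a ((a + b) / 2) ∧
      IntervalIntegrable (fun x => M x ^ 2) volume ((a + b) / 2) b :=
    ⟨(hMc.pow 2).intervalIntegrable _ _, (hMc.pow 2).intervalIntegrable _ _⟩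
  have hi' : IntervalIntegrable (fun x => M' x ^ 2) volume a ((a + b) / 2) ∧
      IntervalIntegrable (fun x => M' x ^ 2) volume ((a + b) / 2) b :=
    ⟨(hM'c.pow 2).intervalIntegrable _ _, (hM'c.pow 2).intervalIntegrable _ _⟩
  have s1 : (∫ x in a..(a + b) / 2, M x ^ 2) + ∫ x in (a + b) / 2..b, M x ^ 2 =
      ∫ x in a..b, M x ^ 2 := intervalIntegral.integral_add_adjacent_intervals hi.1 hi.2
  have s2 : (∫ x in a..(a + b) / 2, M' x ^ 2) + ∫ x in (a + b) / 2..b, M' x ^ 2 =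
      ∫ x in a..b, M' x ^ 2 := intervalIntegral.integral_add_adjacent_intervals hi'.1 hi'.2
  rwa [s1, s2] at h

end HalfShiftWirtinger

end Summit.NavierStokesRegularity.FunctionalMining

end
-- search for candidate a priori estimates; no regularity claim
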